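import Literature.Algebra.EuclideanLattices.BabaiResidual
import HarnessLib

/-!
# The nearest-plane residual is short: `|⟪res, b̃ᵢ⟫| ≤ ‖b̃ᵢ‖²/2` and `‖res‖² ≤ ¼ ∑ ‖b̃ᵢ‖²`

Topic `Algebra/EuclideanLattices` (family `pqc`), sequel of `BabaiResidual.lean` (`Babai.residual k f c`,
the target reduced modulo `L(f)` by Babai's nearest-plane algorithm: shift equivariance, membership).
Everything here is PROVED (theorems only); no named fact.

Babai's classical guarantee (Babai 1986, §3: the output lattice vector `v` of NEAREST PLANE satisfies
`c - v = ∑ tᵢ b̃ᵢ` with `|tᵢ| ≤ ½`, so `‖c - v‖² ≤ ¼ ∑ ‖b̃ᵢ‖²`), in the tree's vocabulary: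

* `Babai.residual_succ` — the recursion of the residual: `residual (k+1) f c = residual k f' (c - ⌊c'⌉ b_last)`
  (`f'` the prefix family, `c'` the last centre);
* `Babai.inner_residual_gramSchmidt_last` — `⟪residual, b̃_last⟫ = ‖b̃_last‖²(c' - ⌊c'⌉)`;
* **`Babai.abs_inner_residual_gramSchmidt_le`** — `|⟪residual k f c, b̃ᵢ⟫| ≤ ‖b̃ᵢ‖²/2` for every `i`
  (all `b̃ᵢ ≠ 0`; induction along the recursion, the prefix family having the same Gram–Schmidt vectors);
* **`Babai.norm_residual_sq_le`** — for a linearly independent family spanning the space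
  (`finrank = k`), `‖residual k f c‖² ≤ (∑ᵢ ‖b̃ᵢ‖²)/4` (expand in the orthonormal basis `b̃ᵢ/‖b̃ᵢ‖`,
  Mathlib's `gramSchmidtOrthonormalBasis`), and `Babai.norm_residual_le` —
  `‖residual k f c‖ ≤ √(∑ᵢ ‖bᵢ‖²)/2` (`‖b̃ᵢ‖ ≤ ‖bᵢ‖`): an a-priori bound on the BDD instance
  `x = residual(w)` of the first component of Peikert's reduction (`Cryptography/PeikertReduction.lean`,
  pqc.S20) in terms of the basis alone, as needed to bound the length of its code.

## References

* L. Babai, *On Lovász' lattice reduction and the nearest lattice point problem*, Combinatorica 6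
  (1986) 1–13, §3 (procedure NEAREST PLANE and its residual bound) [Babai1986].
-/

noncomputable section

open Finset InnerProductSpace Real Module
open scoped RealInnerProductSpace

namespace Literature.Algebra.EuclideanLattices

variable {V : Type*} [NormedAddCommGroup V] [InnerProductSpace ℝ V]

namespace Babai

open GPVSampler

/-! ### The recursion of the residual -/

/-- **One step of the residual**: `residual (k+1) f c = residual k (f ∘ castSucc) (c - ⌊c'_last⌉ b_last)`.
[cite: Babai1986, §3] -/
theorem residual_succ {k : ℕ} (f : Fin (k + 1) → V) (c : V) :
    residual (k + 1) f c =
      residual k (f ∘ Fin.castSucc) (c - (round (lastCenter f c) : ℝ) • f (Fin.last k)) := by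
  rw [residual, residual, nearestPlane_succ, vecOf_succ, Fin.init_snoc, Fin.snoc_last]
  abel

/-- **The last Gram–Schmidt coordinate of the residual**: `⟪residual, b̃_last⟫ = ‖b̃_last‖²(c' - ⌊c'⌉)`.
[cite: Babai1986, §3] -/
theorem inner_residual_gramSchmidt_last {k : ℕ} (f : Fin (k + 1) → V) (c : V)
    (hf : gramSchmidt ℝ f (Fin.last k) ≠ 0) :
    ⟪residual (k + 1) f c, gramSchmidt ℝ f (Fin.last k)⟫ =
      ‖gramSchmidt ℝ f (Fin.last k)‖ ^ 2 * (lastCenter f c - round (lastCenter f c)) := by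
  have h := inner_vecOf_sub_gramSchmidt_last f c (nearestPlane (k + 1) f c) hf
  rw [nearestPlane_succ, Fin.snoc_last] at h
  rw [residual, ← neg_sub, inner_neg_left, nearestPlane_succ, h]
  ring

/-! ### The Gram–Schmidt coordinates of the residual are at most `½` -/

/-- **Babai's residual bound, coordinate form**: `|⟪residual k f c, b̃ᵢ⟫| ≤ ‖b̃ᵢ‖²/2` for every `i`
(all `b̃ᵢ ≠ 0`). [cite: Babai1986, §3] -/
theorem abs_inner_residual_gramSchmidt_le : ∀ (k : ℕ) (f : Fin k → V) (_ : ∀ i, gramSchmidt ℝ f i ≠ 0)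
    (c : V) (i : Fin k), |⟪residual k f c, gramSchmidt ℝ f i⟫| ≤ ‖gramSchmidt ℝ f i‖ ^ 2 / 2
  | 0, _, _, _, i => i.elim0
  | k + 1, f, hf, c, i => by
      have hprefix : ∀ j : Fin k, gramSchmidt ℝ (f ∘ Fin.castSucc) j = gramSchmidt ℝ f (Fin.castSucc j) :=
        fun j => Literature.Analysis.InnerProduct.gramSchmidt_comp_castSucc ℝ f j
      have hf' : ∀ j : Fin k, gramSchmidt ℝ (f ∘ Fin.castSucc) j ≠ 0 := fun j => by
        rw [hprefix]; exact hf _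
      refine Fin.lastCases ?_ (fun j => ?_) i
      · -- the last coordinate: `|c' - ⌊c'⌉| ≤ ½`
        rw [inner_residual_gramSchmidt_last f c (hf _), abs_mul, abs_of_nonneg (sq_nonneg _)]
        have h := abs_sub_round (lastCenter f c)
        have h0 : 0 ≤ ‖gramSchmidt ℝ f (Fin.last k)‖ ^ 2 := sq_nonneg _
        calc ‖gramSchmidt ℝ f (Fin.last k)‖ ^ 2 * |lastCenter f c - ↑(round (lastCenter f c))|
            ≤ ‖gramSchmidt ℝ f (Fin.last k)‖ ^ 2 * (1 / 2) := mul_le_mul_of_nonneg_left h h0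
          _ = ‖gramSchmidt ℝ f (Fin.last k)‖ ^ 2 / 2 := by ring
      · -- an earlier coordinate: recurse on the prefix family
        rw [residual_succ, ← hprefix]
        exact abs_inner_residual_gramSchmidt_le k (f ∘ Fin.castSucc) hf' _ j

/-! ### The norm of the residual -/

/-- **Babai's residual bound**: for a linearly independent family `f : Fin k → V` spanning `V`
(`finrank ℝ V = k`), `‖residual k f c‖² ≤ (∑ᵢ ‖b̃ᵢ‖²)/4` (the residual is `∑ tᵢ b̃ᵢ` with `|tᵢ| ≤ ½`;
expansion in the orthonormal basis `b̃ᵢ/‖b̃ᵢ‖`). [cite: Babai1986, §3] -/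
theorem norm_residual_sq_le {k : ℕ} [FiniteDimensional ℝ V] (hV : finrank ℝ V = k) (f : Fin k → V)
    (hf : LinearIndependent ℝ f) (c : V) :
    ‖residual k f c‖ ^ 2 ≤ (∑ i, ‖gramSchmidt ℝ f i‖ ^ 2) / 4 := by
  have hV' : finrank ℝ V = Fintype.card (Fin k) := by rw [hV, Fintype.card_fin]
  set e := gramSchmidtOrthonormalBasis hV' f with he
  have hgs : ∀ i, gramSchmidt ℝ f i ≠ 0 := fun i => gramSchmidt_ne_zero i hf
  have hei : ∀ i, e i = (‖gramSchmidt ℝ f i‖⁻¹ : ℝ) • gramSchmidt ℝ f i := by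
    intro i
    have hne : gramSchmidtNormed ℝ f i ≠ 0 := by
      intro h0
      have := gramSchmidtNormed_unit_length (𝕜 := ℝ) i hf
      rw [h0, norm_zero] at this
      exact zero_ne_one this
    rw [he, gramSchmidtOrthonormalBasis_apply hV' hne]
    rfl
  rw [← e.sum_sq_inner_right (residual k f c), Finset.sum_div]
  refine Finset.sum_le_sum fun i _ => ?_
  have hpos : 0 < ‖gramSchmidt ℝ f i‖ := norm_pos_iff.2 (hgs i)
  have hb := abs_inner_residual_gramSchmidt_le k f hgs c i
  have hsq : ⟪residual k f c, gramSchmidt ℝ f i⟫ ^ 2 ≤ (‖gramSchmidt ℝ f i‖ ^ 2 / 2) ^ 2 := by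
    rw [← sq_abs]; exact pow_le_pow_left₀ (abs_nonneg _) hb 2
  rw [hei i, real_inner_smul_left, real_inner_comm (residual k f c) (gramSchmidt ℝ f i), mul_pow, inv_pow]
  calc (‖gramSchmidt ℝ f i‖ ^ 2)⁻¹ * ⟪residual k f c, gramSchmidt ℝ f i⟫ ^ 2
      ≤ (‖gramSchmidt ℝ f i‖ ^ 2)⁻¹ * (‖gramSchmidt ℝ f i‖ ^ 2 / 2) ^ 2 :=
        mul_le_mul_of_nonneg_left hsq (by positivity)
    _ = ‖gramSchmidt ℝ f i‖ ^ 2 / 4 := by field_simp; ring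

/-- `‖b̃ₙ‖ ≤ ‖bₙ‖` (`bₙ = b̃ₙ + pₙ` with `pₙ` a combination of the earlier `b̃ᵢ`, orthogonal to `b̃ₙ`);
proved here from Mathlib's `gramSchmidt_def''`/`gramSchmidt_orthogonal` to keep the imports light (the
tree's LLL toolkit has the same inequality as `norm_gramSchmidt_le`). [folklore] -/
theorem norm_gramSchmidt_le_norm {ι : Type*} [LinearOrder ι] [LocallyFiniteOrderBot ι] [WellFoundedLT ι]
    (f : ι → V) (n : ι) : ‖gramSchmidt ℝ f n‖ ≤ ‖f n‖ := by
  set s : V := ∑ i ∈ Iio n, (⟪gramSchmidt ℝ f i, f n⟫ / ‖gramSchmidt ℝ f i‖ ^ 2) • gramSchmidt ℝ f i with hs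
  have hdec : f n = gramSchmidt ℝ f n + s := by
    rw [hs]
    exact_mod_cast gramSchmidt_def'' ℝ f n
  have horth : ⟪gramSchmidt ℝ f n, s⟫ = 0 := by
    rw [hs, inner_sum]
    refine Finset.sum_eq_zero fun i hi => ?_
    rw [real_inner_smul_right, gramSchmidt_orthogonal ℝ f (Finset.mem_Iio.1 hi).ne', mul_zero]
  have hsq : ‖f n‖ ^ 2 = ‖gramSchmidt ℝ f n‖ ^ 2 + ‖s‖ ^ 2 := by
    rw [hdec, ← real_inner_self_eq_norm_sq, ← real_inner_self_eq_norm_sq, ← real_inner_self_eq_norm_sq,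
      inner_add_left, inner_add_right, inner_add_right, horth, real_inner_comm (gramSchmidt ℝ f n) s, horth]
    ring
  have h : ‖gramSchmidt ℝ f n‖ ^ 2 ≤ ‖f n‖ ^ 2 := by rw [hsq]; linarith [sq_nonneg ‖s‖]
  exact (pow_le_pow_iff_left₀ (norm_nonneg _) (norm_nonneg _) two_ne_zero).1 h

/-- **Babai's residual bound in terms of the basis vectors**: `‖residual k f c‖ ≤ √(∑ᵢ ‖bᵢ‖²)/2` for a
linearly independent spanning family. [cite: Babai1986, §3] -/
theorem norm_residual_le {k : ℕ} [FiniteDimensional ℝ V] (hV : finrank ℝ V = k) (f : Fin k → V)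
    (hf : LinearIndependent ℝ f) (c : V) :
    ‖residual k f c‖ ≤ Real.sqrt (∑ i, ‖f i‖ ^ 2) / 2 := by
  have h1 := norm_residual_sq_le hV f hf c
  have h2 : (∑ i, ‖gramSchmidt ℝ f i‖ ^ 2) ≤ ∑ i, ‖f i‖ ^ 2 :=
    Finset.sum_le_sum fun i _ => pow_le_pow_left₀ (norm_nonneg _) (norm_gramSchmidt_le_norm f i) 2
  have h3 : ‖residual k f c‖ ^ 2 ≤ (Real.sqrt (∑ i, ‖f i‖ ^ 2) / 2) ^ 2 := by
    rw [div_pow, Real.sq_sqrt (Finset.sum_nonneg fun i _ => sq_nonneg _)]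
    linarith
  exact (pow_le_pow_iff_left₀ (norm_nonneg _) (by positivity) two_ne_zero).1 h3

end Babai

end Literature.Algebra.EuclideanLattices

end
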